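import Summits.Schanuel.Schanuel.Theorems.RootDecomp1HGauge

/-!
# RootDecomp1H — «SELF-PRESENTATION»: a transverse certificate presents its own point; relation-gauged cells are exact

lens-5 cell decomp-schanuel, generation 16 (THEOREM ROUND: no item, no `closes`, no ledger write; one import; account in
`HOME/decomp-schanuel-lens-5/g16/NODE-g16.md`).

* §3 `expJacobian_injective` / `presented_of_isCertificate`: at a first failure `y` of rank `n` (`LowerRanks n`, `y` `ℚ`-free,
  `trdeg ℚ(y, e^y) < n`) EVERY transverse integer certificate `P` (`IsCertificate n y P`) has an exponential Jacobian with trivial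
  kernel, so `n` of its own rows are a rational Khovanskii system presenting `y` at size `≤ max_i psize P_i`.  Proof: a kernel
  vector `a` gives `v = (a, e^y ⊙ a)` killed by the `n + 1` gradient rows, whose common kernel is `(n-1)`-dimensional (§2) and
  spanned by TANGENT DIRECTIONS `(D_j z_s)_s` of `ℚ`-derivations of `ℂ` dual to `n - 1` algebraically independent elements of
  `ℚ(z)` (§1) — killed by the gradient of every rational relation; Kirby's rational system at a first failure
  (`firstFailure_khovanskii`) then forces `a = 0`.  With `n` directions: `not_isCertificate_of_le_trdeg`, `counterEx_iff_certificate`.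
* §4 `schanuel_iff_finRel`: index the cells by the size `N` of the CERTIFICATE (`FinRel n N` = `FinCS` with `NearOpt`/`ConjStable`
  deleted, one gauge): `Schanuel ↔ ∀ n N, FinRel n N` with NO bridge / near-optimality / conjugation / `FirstFailureNearStable`;
  `finCS_of_finRel`; `finRel_at_of_relBound` (census reduction).  Round-9 reading (`bridgeTransverse_iff_gauge`): the residual asks
  `N(y) ≤ c⋆(y) + 3`; self-presentation is the reverse inequality as a theorem (`presented_at_certGauge`); in the relation gauge
  the bridge disappears and the honest residue is the TAIL of an infinite family of finite, numerically certifiable cells.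
* §5 (g15 Lemma K) `depthOne_of_kepler`: `a θ + b sin θ = 0`, `b ≠ 0` makes `iθ` depth one.
-/


noncomputable section

namespace Summit.Schanuel.Schanuel.Theorems.RootDecomp1HSelf

open Complex Set MvPolynomial
open Literature.NumberTheory.Transcendental (SchanuelRank Khovanskii.ePD exists_derivation_of_algebraicIndependent
  derivation_mvPolynomial_aeval)
open Summit.Schanuel.Schanuel.Theses.RootDecomp1H (FinCS)
open Summit.Schanuel.Schanuel.Theorems.RootDecomp1HClearance (LowerRanks CounterEx)
open Summit.Schanuel.Schanuel.Theorems.RootDecomp1HGauge (Presented NearOpt ConjStable IsCertificate psize certGauge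
  certGauge_spec_of_counterEx FinCSAt stdGauge finCSAt_std_iff)
open Summit.Schanuel.Schanuel.Theorems.MinimalCounterexampleInAcl.Negative (firstFailure_khovanskii)

variable {n : ℕ}

/-! ## 1. Tangent directions of the `ℚ`-locus -/

/-- A `ℂ`-combination of `ℚ`-derivations of `ℂ` that kills a set kills the field the set generates. -/
theorem sum_derivation_eq_zero_of_mem_adjoin {ι : Type*} [Fintype ι] (c : ι → ℂ) (D : ι → Derivation ℚ ℂ ℂ)
    {S : Set ℂ} (hS : ∀ x ∈ S, ∑ i, c i * D i x = 0) {w : ℂ} (hw : w ∈ IntermediateField.adjoin ℚ S) :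
    ∑ i, c i * D i w = 0 := by
  induction hw using IntermediateField.adjoin_induction with
  | mem x hx => exact hS x hx
  | algebraMap q => exact Finset.sum_eq_zero fun i _ => by rw [Derivation.map_algebraMap, mul_zero]
  | add x y _ _ ihx ihy => simp only [map_add, mul_add, Finset.sum_add_distrib, ihx, ihy, add_zero]
  | inv x _ ihx =>
    have h : ∑ i, c i * D i x⁻¹ = -x⁻¹ ^ 2 * ∑ i, c i * D i x := by
      rw [Finset.mul_sum]
      exact Finset.sum_congr rfl fun i _ => by rw [Derivation.leibniz_inv, smul_eq_mul]; ring
    rw [h, ihx, mul_zero]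
  | mul x y _ _ ihx ihy =>
    have h : ∑ i, c i * D i (x * y) = x * ∑ i, c i * D i y + y * ∑ i, c i * D i x := by
      rw [Finset.mul_sum, Finset.mul_sum, ← Finset.sum_add_distrib]
      exact Finset.sum_congr rfl fun i _ => by rw [Derivation.leibniz, smul_eq_mul, smul_eq_mul]; ring
    rw [h, ihx, ihy, mul_zero, mul_zero, add_zero]

/-- **Tangent directions.**  If `ℚ(z)` has transcendence degree `≥ m`, there are `m` `ℂ`-linearly independent vectors
`u_j = (D_j z_s)_s` (`D_j` a `ℚ`-derivation of `ℂ`), each annihilated by the gradient at `z` of EVERY rational relation of `z`. -/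
theorem exists_directions {σ : Type*} [Fintype σ] (z : σ → ℂ) (S : Set ℂ) (hS : S = range z) {m : ℕ}
    (hm : (m : Cardinal) ≤ Algebra.trdeg ℚ ↥(IntermediateField.adjoin ℚ S)) :
    ∃ u : Fin m → σ → ℂ, LinearIndependent ℂ u ∧
      ∀ j (f : MvPolynomial σ ℚ), aeval z f = 0 → ∑ s, aeval z (pderiv s f) * u j s = 0 := by
  classical
  subst hS
  haveI : FaithfulSMul ℚ ↥(IntermediateField.adjoin ℚ (range z)) :=
    (faithfulSMul_iff_algebraMap_injective ℚ _).2 (algebraMap ℚ ↥(IntermediateField.adjoin ℚ (range z))).injective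
  obtain ⟨B, hB⟩ := exists_isTranscendenceBasis ℚ ↥(IntermediateField.adjoin ℚ (range z))
  have hcard : Cardinal.mk (Fin m) ≤ Cardinal.mk B := by
    rw [Cardinal.mk_fin, hB.cardinalMk_eq_trdeg]; exact hm
  obtain ⟨emb⟩ := (Cardinal.le_def _ _).1 hcard
  -- an algebraically independent family `t : Fin m → ℂ` inside `ℚ(z)`, and `ℚ`-derivations of `ℂ` dual to it
  obtain ⟨t, ht, htK⟩ : ∃ t : Fin m → ℂ, AlgebraicIndependent ℚ t ∧ ∀ j, t j ∈ IntermediateField.adjoin ℚ (range z) :=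
    ⟨_, (hB.1.comp _ emb.injective).map' (f := (IntermediateField.adjoin ℚ (range z)).val)
      (fun a b h => Subtype.ext h), fun j => (emb j).1.2⟩
  choose D hD using fun j : Fin m => exists_derivation_of_algebraicIndependent ht (fun i => if i = j then (1 : ℂ) else 0)
  refine ⟨fun j s => D j (z s), ?_, fun j f hf => ?_⟩
  · rw [Fintype.linearIndependent_iff]
    intro c hc j
    have hz : ∀ x ∈ range z, ∑ i, c i * D i x = 0 := by
      rintro _ ⟨s, rfl⟩
      simpa [Finset.sum_apply, Pi.smul_apply, smul_eq_mul] using congr_fun hc s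
    simpa [hD, Finset.sum_ite_eq] using sum_derivation_eq_zero_of_mem_adjoin c D hz (htK j)
  · have h := derivation_mvPolynomial_aeval (D j) z f
    rw [hf, map_zero] at h
    simpa [smul_eq_mul] using h.symm

/-! ## 2. Linear algebra of the gradient rows and of the exponential Jacobian -/

/-- Rank–nullity for `n + 1` independent rows on `ℂ^{Fin n ⊕ Fin n}`: `m` independent common-kernel vectors force `m + 1 ≤ n`,
and `n - 1` of them SPAN the common kernel. -/
theorem kernel_of_rows {m : ℕ} (R : Matrix (Fin (n + 1)) (Fin n ⊕ Fin n) ℂ) (hR : LinearIndependent ℂ R.row)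
    (u : Fin m → Fin n ⊕ Fin n → ℂ) (hu : LinearIndependent ℂ u) (hRu : ∀ j, R.mulVec (u j) = 0) :
    m + 1 ≤ n ∧ (m + 1 = n → ∀ v, R.mulVec v = 0 → v ∈ Submodule.span ℂ (range u)) := by
  classical
  have hrange : Module.finrank ℂ (LinearMap.range R.mulVecLin) = n + 1 := by
    change R.rank = n + 1
    rw [Matrix.rank_eq_finrank_span_row, finrank_span_eq_card hR, Fintype.card_fin]
  have hrn := LinearMap.finrank_range_add_finrank_ker R.mulVecLin
  rw [hrange, Module.finrank_fintype_fun_eq_card, Fintype.card_sum, Fintype.card_fin] at hrn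
  have hle : Submodule.span ℂ (range u) ≤ LinearMap.ker R.mulVecLin := by
    rw [Submodule.span_le]
    rintro _ ⟨j, rfl⟩
    simpa [LinearMap.mem_ker] using hRu j
  have hsp : Module.finrank ℂ (Submodule.span ℂ (range u)) = m := by
    rw [finrank_span_eq_card hu, Fintype.card_fin]
  have hmono := Submodule.finrank_mono hle
  rw [hsp] at hmono
  refine ⟨by omega, fun hmn v hv => ?_⟩
  have heq : Submodule.span ℂ (range u) = LinearMap.ker R.mulVecLin :=
    Submodule.eq_of_le_of_finrank_eq hle (by rw [hsp]; omega)
  rw [heq, LinearMap.mem_ker, Matrix.mulVecLin_apply]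
  exact hv

/-- An `(n+1) × n` matrix with trivial kernel has `n` rows with non-zero determinant. -/
theorem exists_submatrix_det_ne_zero (J : Matrix (Fin (n + 1)) (Fin n) ℂ) (hJ : ∀ a, J.mulVec a = 0 → a = 0) :
    ∃ e : Fin n → Fin (n + 1), (J.submatrix e id).det ≠ 0 := by
  classical
  have hinj : Function.Injective J.mulVecLin :=
    (injective_iff_map_eq_zero _).2 fun a ha => hJ a (by simpa using ha)
  have hspan : Submodule.span ℂ (range J.row) = ⊤ := by
    apply Submodule.eq_top_of_finrank_eq
    rw [← Matrix.rank_eq_finrank_span_row, Matrix.rank, LinearMap.finrank_range_of_inj hinj]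
  obtain ⟨b, hbsub, hbspan, hbli⟩ := exists_linearIndependent ℂ (range J.row)
  haveI : Fintype b := ((Set.finite_range J.row).subset hbsub).fintype
  have hbcard : Fintype.card b = n := by
    have h := finrank_span_eq_card hbli
    rw [Subtype.range_coe, hbspan, hspan, finrank_top, Module.finrank_fintype_fun_eq_card, Fintype.card_fin] at h
    exact h.symm
  have hpre : ∀ w : b, ∃ i, J.row i = w := fun w => hbsub w.2
  choose idx hidx using hpre
  let ε : Fin n ≃ b := (Fintype.equivFinOfCardEq hbcard).symm
  refine ⟨fun k => idx (ε k), ?_⟩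
  have hrows : (J.submatrix (fun k => idx (ε k)) id).row = (Subtype.val : b → (Fin n → ℂ)) ∘ ε := by
    funext k
    ext j
    have := congr_fun (hidx (ε k)) j
    simpa [Matrix.row_def] using this
  have hli : LinearIndependent ℂ (J.submatrix (fun k => idx (ε k)) id).row := by
    rw [hrows]; exact hbli.comp _ ε.injective
  exact ((Matrix.isUnit_iff_isUnit_det _).1 (Matrix.linearIndependent_rows_iff_isUnit.1 hli)).ne_zero

/-! ## 3. Self-presentation -/

/-- The exponential Jacobian applied to `a` is the full gradient paired with the vector `(a, e^y ⊙ a)`. -/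
theorem sum_ePD_mul_eq (y : Fin n → ℂ) (f : MvPolynomial (Fin n ⊕ Fin n) ℚ) (a : Fin n → ℂ) :
    ∑ j, aeval (Sum.elim y (cexp ∘ y)) (Khovanskii.ePD j f) * a j =
      ∑ s, aeval (Sum.elim y (cexp ∘ y)) (pderiv s f) * Sum.elim a (fun j => cexp (y j) * a j) s := by
  rw [Fintype.sum_sum_type, ← Finset.sum_add_distrib]
  refine Finset.sum_congr rfl fun j _ => ?_
  simp only [Khovanskii.ePD, map_add, map_mul, aeval_X, Sum.elim_inl, Sum.elim_inr, Function.comp_apply]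
  ring

/-- The integer gradient read through `ℚ`. -/
theorem aeval_pderiv_map {σ : Type*} (z : σ → ℂ) (P : MvPolynomial σ ℤ) (s : σ) :
    aeval z (pderiv s (map (algebraMap ℤ ℚ) P)) = aeval z (pderiv s P) := by
  rw [pderiv_map, aeval_map_algebraMap]

/-- **NO CERTIFICATE AT THE FULL DEGREE** (by counting tangent directions): `trdeg ℚ(y, e^y) ≥ n` forbids certificates. -/
theorem not_isCertificate_of_le_trdeg {y : Fin n → ℂ}
    (hn : (n : Cardinal) ≤ Algebra.trdeg ℚ ↥(IntermediateField.adjoin ℚ (range y ∪ range (cexp ∘ y))))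
    (P : Fin (n + 1) → MvPolynomial (Fin n ⊕ Fin n) ℤ) : ¬ IsCertificate n y P := by
  rintro ⟨hP0, hG⟩
  obtain ⟨u, hu, hsol⟩ := exists_directions (Sum.elim y (cexp ∘ y)) _ (Set.Sum.elim_range _ _).symm hn
  have h := (kernel_of_rows (fun i s => aeval (Sum.elim y (cexp ∘ y)) (pderiv s (P i))) hG u hu fun j => ?_).1
  · omega
  · funext i
    have := hsol j (map (algebraMap ℤ ℚ) (P i)) (by rw [aeval_map_algebraMap]; exact hP0 i)
    simp only [aeval_pderiv_map] at this
    simpa [Matrix.mulVec, dotProduct] using this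

/-- Hence a `ℚ`-free tuple with a certificate IS a counterexample (converse of `exists_certificate_of_trdeg_lt`). -/
theorem counterEx_of_isCertificate {y : Fin n → ℂ} (hli : LinearIndependent ℚ y)
    {P : Fin (n + 1) → MvPolynomial (Fin n ⊕ Fin n) ℤ} (hc : IsCertificate n y P) : CounterEx y :=
  ⟨hli, not_le.1 fun h => not_isCertificate_of_le_trdeg h P hc⟩

/-- `y` is a counterexample of rank `n` iff it is `ℚ`-free and carries a transverse integer certificate. -/
theorem counterEx_iff_certificate {y : Fin n → ℂ} :
    CounterEx y ↔ LinearIndependent ℚ y ∧ ∃ P, IsCertificate n y P :=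
  ⟨fun h => ⟨h.1, RootDecomp1HGauge.exists_certificate_of_trdeg_lt h.2⟩,
    fun ⟨hli, _, hc⟩ => counterEx_of_isCertificate hli hc⟩

/-- The ranks below `n` give `trdeg ℚ(y, e^y) ≥ n - 1` at a `ℚ`-free `y` (drop the last coordinate). -/
theorem pred_le_trdeg {y : Fin n → ℂ} (hli : LinearIndependent ℚ y) (hlow : LowerRanks n) :
    ((n - 1 : ℕ) : Cardinal) ≤ Algebra.trdeg ℚ ↥(IntermediateField.adjoin ℚ (range y ∪ range (cexp ∘ y))) := by
  cases n with
  | zero => simp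
  | succ m =>
    have h := hlow m (Nat.lt_succ_self m) (y ∘ Fin.castSucc) (hli.comp _ (Fin.castSucc_injective m))
    simp only [Nat.add_sub_cancel]
    refine h.trans (RootDecomp1HTowerCells.trdeg_le_of_mem_span_int y (y ∘ Fin.castSucc) fun i => ?_)
    exact Submodule.subset_span ⟨Fin.castSucc i, rfl⟩

/-- **SELF-PRESENTATION, kernel form.**  At a first failure every certificate's exponential Jacobian has trivial kernel. -/
theorem expJacobian_injective {y : Fin n → ℂ} (hli : LinearIndependent ℚ y)
    (hlt : Algebra.trdeg ℚ ↥(IntermediateField.adjoin ℚ (range y ∪ range (cexp ∘ y))) < (n : Cardinal))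
    (hlow : LowerRanks n) {P : Fin (n + 1) → MvPolynomial (Fin n ⊕ Fin n) ℤ} (hc : IsCertificate n y P)
    (a : Fin n → ℂ)
    (ha : (Matrix.of fun i j =>
      aeval (Sum.elim y (cexp ∘ y)) (Khovanskii.ePD j (map (algebraMap ℤ ℚ) (P i)))).mulVec a = 0) :
    a = 0 := by
  classical
  obtain ⟨hP0, hG⟩ := hc
  have hn : 1 ≤ n := by
    rcases Nat.eq_zero_or_pos n with rfl | h
    · simp at hlt
    · exact h
  -- `n - 1` tangent directions span the common kernel of the `n + 1` gradient rows
  obtain ⟨u, hu, hsol⟩ :=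
    exists_directions (Sum.elim y (cexp ∘ y)) _ (Set.Sum.elim_range _ _).symm (pred_le_trdeg hli hlow)
  have hRu : ∀ j, Matrix.mulVec (fun i s => aeval (Sum.elim y (cexp ∘ y)) (pderiv s (P i))) (u j) = 0 := fun j => by
    funext i
    have := hsol j (map (algebraMap ℤ ℚ) (P i)) (by rw [aeval_map_algebraMap]; exact hP0 i)
    simp only [aeval_pderiv_map] at this
    simpa [Matrix.mulVec, dotProduct] using this
  have hspan := (kernel_of_rows (fun i s => aeval (Sum.elim y (cexp ∘ y)) (pderiv s (P i))) hG u hu hRu).2 (by omega)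
  -- the vector `v = (a, e^y ⊙ a)` lies in that kernel
  have hRv : Matrix.mulVec (fun i s => aeval (Sum.elim y (cexp ∘ y)) (pderiv s (P i)))
      (Sum.elim a (fun j => cexp (y j) * a j)) = 0 := by
    funext i
    have hi := congr_fun ha i
    simp only [Matrix.mulVec, dotProduct, Matrix.of_apply, Pi.zero_apply] at hi
    rw [sum_ePD_mul_eq] at hi
    simp only [aeval_pderiv_map] at hi
    simpa [Matrix.mulVec, dotProduct] using hi
  obtain ⟨c, hcv⟩ := (Submodule.mem_span_range_iff_exists_fun ℂ).1 (hspan _ hRv)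
  -- Kirby's rational Khovanskii system at the first failure kills every tangent direction, hence `v`, hence `a`
  obtain ⟨g, hg0, hdet⟩ := firstFailure_khovanskii hli hlt hlow
  refine Matrix.eq_zero_of_mulVec_eq_zero hdet (funext fun i => ?_)
  simp only [Matrix.mulVec, dotProduct, Matrix.of_apply, Pi.zero_apply]
  rw [sum_ePD_mul_eq, ← hcv]
  simp only [Finset.sum_apply, Pi.smul_apply, smul_eq_mul, Finset.mul_sum]
  rw [Finset.sum_comm]
  refine Finset.sum_eq_zero fun j _ => ?_
  have hj := hsol j (g i) (hg0 i)
  calc ∑ s, aeval (Sum.elim y (cexp ∘ y)) (pderiv s (g i)) * (c j * u j s)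
        = c j * ∑ s, aeval (Sum.elim y (cexp ∘ y)) (pderiv s (g i)) * u j s := by
          rw [Finset.mul_sum]; exact Finset.sum_congr rfl fun s _ => by ring
    _ = 0 := by rw [hj, mul_zero]

/-- The rational size of an integer polynomial read in `ℚ` is at most its integer size. -/
theorem qsize_le_psize {σ : Type*} (P : MvPolynomial σ ℤ) :
    max (map (algebraMap ℤ ℚ) P).totalDegree ((map (algebraMap ℤ ℚ) P).support.sup fun m =>
      max ((map (algebraMap ℤ ℚ) P).coeff m).num.natAbs ((map (algebraMap ℤ ℚ) P).coeff m).den) ≤ psize P := by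
  have hinj : Function.Injective (algebraMap ℤ ℚ) := fun a b h => by simpa using h
  have hsupp : (map (algebraMap ℤ ℚ) P).support = P.support := support_map_of_injective P hinj
  unfold psize
  refine max_le ?_ ?_
  · have : (map (algebraMap ℤ ℚ) P).totalDegree = P.totalDegree := by simp only [totalDegree, hsupp]
    rw [this]; exact le_max_left _ _
  · rw [hsupp]
    refine Finset.sup_le fun m hm => ?_
    have hne : P.coeff m ≠ 0 := mem_support_iff.1 hm
    have hcoef : (map (algebraMap ℤ ℚ) P).coeff m = ((P.coeff m : ℤ) : ℚ) := by
      rw [coeff_map]; simp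
    have hsup : (P.coeff m).natAbs ≤ P.support.sup fun m => (P.coeff m).natAbs :=
      Finset.le_sup (f := fun m => (P.coeff m).natAbs) hm
    rw [hcoef, Rat.num_intCast, Rat.den_intCast]
    exact max_le (hsup.trans (le_max_right _ _))
      ((Nat.succ_le_of_lt (Int.natAbs_pos.2 hne)).trans (hsup.trans (le_max_right _ _)))

/-- **SELF-PRESENTATION.**  At a first failure `y`, every transverse integer certificate of size `≤ N` with `‖y‖ ≤ 4^N`
presents `y` at size `N`: `n` of its own rows are a rational Khovanskii system at `y`. -/
theorem presented_of_isCertificate {y : Fin n → ℂ} (hli : LinearIndependent ℚ y)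
    (hlt : Algebra.trdeg ℚ ↥(IntermediateField.adjoin ℚ (range y ∪ range (cexp ∘ y))) < (n : Cardinal))
    (hlow : LowerRanks n) {P : Fin (n + 1) → MvPolynomial (Fin n ⊕ Fin n) ℤ} (hc : IsCertificate n y P)
    {N : ℕ} (hN : ∀ i, psize (P i) ≤ N) (hnorm : ‖y‖ ≤ ((4 ^ N : ℕ) : ℝ)) : Presented n N y := by
  obtain ⟨e, he⟩ := exists_submatrix_det_ne_zero _ (expJacobian_injective hli hlt hlow hc)
  exact ⟨⟨fun k => map (algebraMap ℤ ℚ) (P (e k)), fun k => (qsize_le_psize _).trans (hN _),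
    fun k => by rw [aeval_map_algebraMap]; exact hc.1 _, he⟩, hnorm⟩

/-- Presentation is monotone in the gauge. -/
theorem presented_mono {c c' : ℕ} {y : Fin n → ℂ} (hcc : c ≤ c') (hp : Presented n c y) : Presented n c' y := by
  obtain ⟨⟨g, hg, hg0, hdet⟩, hnorm⟩ := hp
  refine ⟨⟨g, fun i => (hg i).trans hcc, hg0, hdet⟩, hnorm.trans ?_⟩
  exact_mod_cast Nat.pow_le_pow_right (by norm_num) hcc

/-- Round-9 words: a counterexample above the lower ranks is presented at level `max (certGauge n y) k` whenever `‖y‖ ≤ 4^k`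
— the PRESENTATION gauge is bounded by the CERTIFICATE gauge (the reverse inequality to `GaugeBound`). -/
theorem presented_at_certGauge {y : Fin n → ℂ} (hlow : LowerRanks n) (hce : CounterEx y) {k : ℕ}
    (hk : ‖y‖ ≤ ((4 ^ k : ℕ) : ℝ)) : Presented n (max (certGauge n y) k) y := by
  obtain ⟨P, hPN, hc⟩ := certGauge_spec_of_counterEx hce
  refine presented_of_isCertificate hce.1 hce.2 hlow hc (fun i => (hPN i).trans (le_max_left _ _)) (hk.trans ?_)
  exact_mod_cast Nat.pow_le_pow_right (by norm_num) (le_max_right _ _)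

/-! ## 4. The relation-gauged cells are exact -/

/-- **THE RELATION-GAUGED CELL `(n, N)`**: every tuple presented at size `N` is `ℚ`-dependent or carries no transverse integer
certificate of size `≤ N` (the text of `FinCS` without `NearOpt` / `ConjStable`; one gauge for presentation and certificate). -/
def FinRel (n N : ℕ) : Prop :=
  LowerRanks n → ∀ y : Fin n → ℂ, Presented n N y →
    (¬ LinearIndependent ℚ y ∨ ¬ ∃ P : Fin (n + 1) → MvPolynomial (Fin n ⊕ Fin n) ℤ, (∀ i, psize (P i) ≤ N) ∧ IsCertificate n y P)

/-- Cells are consequences of Schanuel (a `ℚ`-free tuple with a certificate would be a counterexample, § 3). -/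
theorem finRel_of_schanuelRank (h : SchanuelRank n) (N : ℕ) : FinRel n N := by
  intro _ y _
  by_cases hli : LinearIndependent ℚ y
  · exact Or.inr fun ⟨P, _, hc⟩ => not_isCertificate_of_le_trdeg (h y hli) P hc
  · exact Or.inl hli

/-- «RELATIONS BOUNDED TO SIZE `N` at `y`»: the gradients at `(y, e^y)` of all integer relations of size `≤ N` lie in one
subspace of dimension `≤ n` (an EXCL(`N`) certificate modulo the presenting system gives this with `W` = span of the `n`
presenting gradients: every relation of size `≤ N` then lies in the ideal of the presenting equations). -/
def RelBound (n N : ℕ) (y : Fin n → ℂ) : Prop :=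
  ∃ W : Submodule ℂ (Fin n ⊕ Fin n → ℂ), Module.finrank ℂ W ≤ n ∧
    ∀ P : MvPolynomial (Fin n ⊕ Fin n) ℤ, psize P ≤ N → aeval (Sum.elim y (cexp ∘ y)) P = 0 →
      (fun s => aeval (Sum.elim y (cexp ∘ y)) (pderiv s P)) ∈ W

/-- **Census reduction in the relation gauge**: relations bounded to size `N` at `y` decide the instance at `y` of EVERY cell
`FinRel n N'`, `N' ≤ N` — no bridge, no optimality, no conjugation screen, no lower-rank binder. -/
theorem finRel_at_of_relBound {N N' : ℕ} (hNN : N' ≤ N) {y : Fin n → ℂ} (h : RelBound n N y) :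
    ¬ LinearIndependent ℚ y ∨
      ¬ ∃ P : Fin (n + 1) → MvPolynomial (Fin n ⊕ Fin n) ℤ, (∀ i, psize (P i) ≤ N') ∧ IsCertificate n y P := by
  obtain ⟨W, hW, hmem⟩ := h
  refine Or.inr fun ⟨P, hPN, hP0, hG⟩ => ?_
  have hin : ∀ i, (fun s => aeval (Sum.elim y (cexp ∘ y)) (pderiv s (P i))) ∈ W :=
    fun i => hmem (P i) ((hPN i).trans hNN) (hP0 i)
  have hli : LinearIndependent ℂ (fun i => (⟨_, hin i⟩ : W)) := LinearIndependent.of_comp W.subtype hG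
  have hcard := hli.fintype_card_le_finrank
  rw [Fintype.card_fin] at hcard
  omega

/-- **EXACTNESS, rank by rank**: above the lower ranks, rank `n` of Schanuel's conjecture IS the conjunction of the
relation-gauged cells of rank `n` — no bridge, no optimality, no conjugation-stability. -/
theorem schanuelRank_iff_finRel (hlow : LowerRanks n) : SchanuelRank n ↔ ∀ N, FinRel n N := by
  refine ⟨fun h N => finRel_of_schanuelRank h N, fun h y hli => ?_⟩
  by_contra hlt
  rw [not_le] at hlt
  obtain ⟨P, hPN, hc⟩ := certGauge_spec_of_counterEx ⟨hli, hlt⟩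
  obtain ⟨k, hk⟩ := exists_nat_ge ‖y‖
  have hk' : ‖y‖ ≤ ((4 ^ k : ℕ) : ℝ) := hk.trans (by exact_mod_cast (Nat.lt_pow_self (by norm_num : 1 < 4)).le)
  have hpres := presented_at_certGauge hlow ⟨hli, hlt⟩ hk'
  rcases h _ hlow y hpres with hdep | hno
  · exact hdep hli
  · exact hno ⟨P, fun i => (hPN i).trans (le_max_left _ _), hc⟩

/-- **EXACTNESS**: `Schanuel ↔ ∀ n N, FinRel n N`. -/
theorem schanuel_iff_finRel : _root_.Schanuel ↔ ∀ n N, FinRel n N := by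
  refine ⟨fun h n N => finRel_of_schanuelRank (h n) N, fun h n => ?_⟩
  induction n using Nat.strong_induction_on with
  | _ n ih => exact (schanuelRank_iff_finRel ih).2 (h n)

/-- The live instrument `FinCS` (27287) is a sub-family of the cells (drop `NearOpt`'s minimality and `ConjStable`; `c ↦ c+3`). -/
theorem finCS_of_finRel (h : ∀ n N, FinRel n N) : FinCS := by
  rw [← finCSAt_std_iff]
  intro n c hlow y hopt _
  rcases h n (c + 3) hlow y (presented_mono (Nat.le_add_right c 3) hopt.1) with hdep | hno
  · exact Or.inl hdep
  · exact Or.inr hno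

/-! ## 5. The Kepler pin (g15 Lemma K) -/

/-- **THE KEPLER PIN** (g15 NODE §P4, Lemma K): a relation `a θ + b sin θ = 0` with `b ≠ 0` (`a b : ℚ`, `θ : ℝ`) makes `iθ`
DEPTH ONE — for `a = 0`, `e^{iθ} = ±1`; for `a ≠ 0`, `iθ = (b / 2a) (Y⁻¹ − Y) ∈ ℚ(Y)` with `Y = e^{iθ}`. -/
theorem depthOne_of_kepler {θ : ℝ} {a b : ℚ} (hb : b ≠ 0) (h : (a : ℝ) * θ + (b : ℝ) * Real.sin θ = 0) :
    Algebra.trdeg ℚ ↥(IntermediateField.adjoin ℚ ({(θ : ℂ) * I, cexp ((θ : ℂ) * I)} : Set ℂ)) ≤ 1 := by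
  rcases eq_or_ne a 0 with rfl | ha
  · have hb' : (b : ℝ) ≠ 0 := by exact_mod_cast hb
    have hsin : Real.sin θ = 0 := by simpa [hb'] using h
    obtain ⟨k, hk⟩ := Real.sin_eq_zero_iff.1 hsin
    apply RootDecomp1HCurveHull.depthOne_of_isAlgebraic_exp
    have hexp : cexp ((θ : ℂ) * I) = algebraMap ℚ ℂ ((-1 : ℚ) ^ k) := by
      rw [← hk]
      push_cast
      rw [mul_assoc, Complex.exp_int_mul, Complex.exp_pi_mul_I]
    rw [hexp]
    exact isAlgebraic_algebraMap _
  · set Y := cexp ((θ : ℂ) * I) with hY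
    have ha' : (a : ℂ) ≠ 0 := by exact_mod_cast ha
    have h' : (a : ℂ) * θ + b * Complex.sin θ = 0 := by
      have := congrArg (fun r : ℝ => (r : ℂ)) h
      push_cast at this
      simpa using this
    have hθ : (θ : ℂ) = -(b : ℂ) / a * Complex.sin θ := by
      field_simp
      linear_combination h'
    have hsin : Complex.sin θ = (Y⁻¹ - Y) * I / 2 := by
      rw [Complex.sin, neg_mul, Complex.exp_neg]
    have hX : (θ : ℂ) * I = ((b / (2 * a) : ℚ) : ℂ) * (Y⁻¹ - Y) := by
      rw [hθ, hsin]
      push_cast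
      linear_combination (-(b : ℂ) / (2 * a) * (Y⁻¹ - Y)) * Complex.I_mul_I
    have hYmem : Y ∈ IntermediateField.adjoin ℚ ({Y} : Set ℂ) := IntermediateField.subset_adjoin ℚ _ rfl
    have hmem : (θ : ℂ) * I ∈ IntermediateField.adjoin ℚ ({Y} : Set ℂ) := by
      rw [hX]
      exact mul_mem (by exact_mod_cast (IntermediateField.adjoin ℚ ({Y} : Set ℂ)).algebraMap_mem (b / (2 * a)))
        (sub_mem (inv_mem hYmem) hYmem)
    have hle : IntermediateField.adjoin ℚ ({(θ : ℂ) * I, Y} : Set ℂ) ≤ IntermediateField.adjoin ℚ ({Y} : Set ℂ) :=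
      IntermediateField.adjoin_le_iff.mpr (Set.insert_subset_iff.mpr ⟨hmem, IntermediateField.subset_adjoin ℚ _⟩)
    exact (Literature.Barriers.Schanuel.trdeg_mono hle).trans
      (RootDecomp1HCurveHull.trdeg_adjoin_le_one_of_subsingleton Set.subsingleton_singleton)

end Summit.Schanuel.Schanuel.Theorems.RootDecomp1HSelf

end
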